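import Summits.ValiantsHypothesis.ValiantsHypothesis.Theorems.BarrierLeverNaturalProofsAgainstAllLinearSizes
import Literature.Barriers.ValiantsHypothesis.AlgebraicNaturalProofsKRSTVNP

/-!
# Route BarrierLever — item `NaturalProofsSeparateVNP` (stmt-ValiantsHypothesis-18972):
# its LINEAR-SIZE RANGE holds unconditionally (partial range `b ≤ 1`, stated honestly)

Helper file (`--supports stmt-ValiantsHypothesis-18972`; cell valiant-natproofs, seat val-np-p4 gen 4).
Closes NO item; no definitions.

The item `S := Theses.BarrierLever.NaturalProofsSeparateVNP` reads, in its level-`a` form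
(`…NaturalProofsSeparateVNPLevel`, `naturalProofsSeparateVNP_iff_level`, every `a ≥ 1`):
ONE exponent `b₁`; for EVERY size exponent `b`, infinitely often in `n`, a level-`a` natural proof
against `SmallCircuits ℂ n b = {deg ≤ n, L ≤ n^b}` with a non-root in `SmallDefinable ℂ n b₁`.
This file proves the `b ≤ 1` instances of that universal quantifier — indeed the whole LINEAR range
`L ≤ c·n`, every `c`, and ALMOST EVERYWHERE in `n` — by re-reading the cell's closed item 20156
(`NaturalProofsAgainstAllLinearSizes`: Baur–Strassen × Macaulay made `poly(N)`-constructive, planner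
p2-g4 / prover gen 4 / val-np-p1) together with its explicit non-root:

* `eval_certPoly_fermat_ne_zero` — the level-`a(c)` distinguisher `certPoly n k` of item 20156 takes
  the value `1 ≠ 0` at the padded Fermat polynomial `Σ_{i<k} x_i^n / n` (the computation inside
  `certPoly_ne_zero`, now recorded AT the point);
* `fermat_mem_smallCircuits` / `fermat_mem_smallDefinable` — that polynomial lies in
  `SmallCircuits ℂ n 3 ⊆ SmallDefinable ℂ n 3` (`k(n+2) ≤ n³` gates; one Boolean-free `boolSum`);
* **`naturalProofsSeparate_linearSize`** — for every `c` there are `a = 84c+39` and `n₀` such that for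
  ALL `n ≥ n₀` some `D ∈ Distinguishers ℂ n a` is an FSV-natural proof against
  `{f : deg f ≤ n, L(f) ≤ c·n}` AND has a non-root in `SmallDefinable ℂ n 3` (indeed in
  `SmallCircuits ℂ n 3`, `naturalProofsSeparate_linearSize_vp`);
* **`naturalProofsSeparateVNP_range_one`** — hence the `b = 1` (and `b = 0`) instance of the item's
  level-`a` form HOLDS, with `b₁ = 3`, for all large `n`:
  `∀ n₀, ∃ n ≥ n₀, ∃ D, IsNaturalProof _ (SmallCircuits ℂ n 1) (Distinguishers ℂ n 123) D ∧
   ∃ g ∈ SmallDefinable ℂ n 3, D(coeff g) ≠ 0`.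

RANGE STATEMENT (honest): the item needs this for EVERY `b`; `b ≤ 1` (all linear sizes) is proved
here; `b = 2` alone would be an algebraically natural SUPER-LINEAR (`n²`) circuit lower bound for an
explicit `VNP` (here even `VP`) family of degree `≤ n` — open (the method's ceiling is `Θ(n log n)`,
Baur–Strassen); the full item implies `VP ≠ VNP` (`valiantsHypothesis_of_naturalProofsSeparateVNP`)
and stays OPEN, parked on the crux (item 14610). The level `a(c) = 84c+39` is that of item 20156; the
item's own level one is immaterial only in the presence of ALL `b` (the padding of `…Level` trades
level for size exponent), so no level-one claim is made for the linear range.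

References: [BaurStrassen1983]; [Strassen1973] (degree bound); [ForbesShpilkaVolk2018] Def. 1,
§1.2 ("essentially all known lower bounds are natural"), Question 6; [KumarRamyaSaptharishiTengse2022]
§1.2 (the `VNP` slices `SmallDefinable`).
-/

-- layout Summits/ValiantsHypothesis/ValiantsHypothesis forces the duplicated namespace component
set_option linter.dupNamespace false

noncomputable section

namespace Summit.ValiantsHypothesis.ValiantsHypothesis.Theorems.BarrierLever.NaturalProofsSeparateVNP

open MvPolynomial Finset
open Literature.Computability.AlgebraicComplexity Literature.Barriers.ValiantsHypothesis
open Literature.RingTheory.MvPolynomial.Macaulay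
open Summit.ValiantsHypothesis.ValiantsHypothesis.Theorems.BarrierLever.NaturalProofsAgainstAllLinearSizes

namespace LinearRange

/-! ### The explicit non-root of item 20156's distinguisher: the padded Fermat polynomial -/

/-- The padded Fermat polynomial `Σ_{i<k} x_i^n / n` has degree `≤ n`. [cite: BaurStrassen1983] -/
theorem totalDegree_fermat_le {n k : ℕ} (hk : k ≤ n) :
    (∑ i : Fin k, C ((n : ℂ)⁻¹) * X (Fin.castLE hk i) ^ n : MvPolynomial (Fin n) ℂ).totalDegree ≤ n := by
  refine totalDegree_finsetSum_le fun i _ => (totalDegree_mul _ _).trans ?_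
  rw [totalDegree_C, totalDegree_X_pow, zero_add]

/-- **Item 20156's certificate is `1` at the padded Fermat polynomial** `Σ_{i<k} x_i^n / n`: its
restriction to the first `k` coordinates is the Fermat form, whose gradient is `(x_i^{n-1})_i`, whose
Macaulay matrix is the identity (`det_macaulay_X_pow`) — the computation of `certPoly_ne_zero`,
recorded at the point. [cite: CoxLittleOSheaUsing2005, Ch. 3 §4] -/
theorem eval_certPoly_fermat {n k : ℕ} (hn : 1 ≤ n) (hk : k ≤ n) :
    eval (coeffVector (degLEMonomials n)
      (∑ i : Fin k, C ((n : ℂ)⁻¹) * X (Fin.castLE hk i) ^ n)) (certPoly n k) = 1 := by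
  classical
  set f₀ : MvPolynomial (Fin n) ℂ := ∑ i : Fin k, C ((n : ℂ)⁻¹) * X (Fin.castLE hk i) ^ n
    with hf₀def
  set F₀ : MvPolynomial (Fin k) ℂ := ∑ i : Fin k, C ((n : ℂ)⁻¹) * X i ^ n with hF₀def
  have hres : aeval (restr ℂ n k) f₀ = F₀ := by
    simp only [hf₀def, hF₀def, map_sum, map_mul, map_pow, aeval_X, restr_castLE, aeval_C,
      algebraMap_eq]
  have hhom : F₀.IsHomogeneous n := by
    refine IsHomogeneous.sum _ _ _ fun i _ => ?_
    simpa using (isHomogeneous_C (Fin k) ((n : ℂ)⁻¹)).mul (isHomogeneous_X_pow (i : Fin k) n)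
  have hn0 : (n : ℂ) ≠ 0 := Nat.cast_ne_zero.2 (by omega)
  have hpd : ∀ i : Fin k, pderiv i F₀ = X i ^ (n - 1) := by
    intro i
    rw [hF₀def, map_sum, Finset.sum_eq_single i]
    · rw [pderiv_C_mul, pderiv_pow, pderiv_X_self, mul_one, ← mul_assoc, ← map_natCast C n,
        ← map_mul, inv_mul_cancel₀ hn0, map_one, one_mul]
    · intro j _ hj
      rw [pderiv_C_mul, pderiv_pow, pderiv_X_of_ne hj, mul_zero, mul_zero]
    · simp
  rw [eval_certPoly k f₀ (totalDegree_fermat_le hk), hres, homogeneousComponent_eq_self hhom]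
  simp_rw [hpd]
  exact det_macaulay_X_pow

/-- Hence the certificate does not vanish at the padded Fermat polynomial. [cite: BaurStrassen1983] -/
theorem eval_certPoly_fermat_ne_zero {n k : ℕ} (hn : 1 ≤ n) (hk : k ≤ n) :
    eval (coeffVector (degLEMonomials n)
      (∑ i : Fin k, C ((n : ℂ)⁻¹) * X (Fin.castLE hk i) ^ n)) (certPoly n k) ≠ 0 := by
  rw [eval_certPoly_fermat hn hk]
  exact one_ne_zero

/-! ### The non-root is `VP`- and `VNP`-succinct (exponent `3`) -/

/-- `L(x_i^e) ≤ e` (iterated products; constants and variables are free). [folklore] -/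
theorem complexity_X_pow_le_self {n : ℕ} (i : Fin n) :
    ∀ e : ℕ, complexity (X i ^ e : MvPolynomial (Fin n) ℂ) ≤ e
  | 0 => by rw [pow_zero, ← C_1, complexity_C_holds]
  | e + 1 => by
      rw [pow_succ]
      calc complexity (X i ^ e * X i) ≤ complexity (X i ^ e) + complexity (X i : MvPolynomial (Fin n) ℂ) + 1 :=
            complexity_mul_le_holds _ _
        _ ≤ e + 0 + 1 := by rw [complexity_X_holds]; exact Nat.add_le_add_right (Nat.add_le_add_right
            (complexity_X_pow_le_self i e) _) _
        _ = e + 1 := by ring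

/-- The padded Fermat polynomial has `L ≤ k(n+2)` (crude: `x^n` by `n` products; repeated squaring
would give `O(k log n)`, not needed). [folklore] -/
theorem complexity_fermat_le {n k : ℕ} (hk : k ≤ n) (c : ℂ) :
    complexity (∑ i : Fin k, C c * X (Fin.castLE hk i) ^ n : MvPolynomial (Fin n) ℂ) ≤ k * (n + 2) := by
  calc complexity (∑ i : Fin k, C c * X (Fin.castLE hk i) ^ n : MvPolynomial (Fin n) ℂ)
      ≤ ∑ i : Fin k, complexity (C c * X (Fin.castLE hk i) ^ n : MvPolynomial (Fin n) ℂ) +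
          (Finset.univ : Finset (Fin k)).card := complexity_finset_sum_le _ _
    _ ≤ ∑ _i : Fin k, (n + 1) + (Finset.univ : Finset (Fin k)).card := by
        gcongr with i
        calc complexity (C c * X (Fin.castLE hk i) ^ n : MvPolynomial (Fin n) ℂ)
            ≤ complexity (C c : MvPolynomial (Fin n) ℂ) + complexity (X (Fin.castLE hk i) ^ n :
                MvPolynomial (Fin n) ℂ) + 1 := complexity_mul_le_holds _ _
          _ ≤ 0 + n + 1 := by
              rw [complexity_C_holds]
              exact Nat.add_le_add_right (Nat.add_le_add_left (complexity_X_pow_le_self _ n) _) _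
          _ = n + 1 := by ring
    _ = k * (n + 2) := by rw [Finset.sum_const, Finset.card_univ, Fintype.card_fin, smul_eq_mul]; ring

/-- **The non-root is `VP`-succinct**: the padded Fermat polynomial lies in `SmallCircuits ℂ n 3`
(`k(n+2) ≤ n(n+2) ≤ n³` for `n ≥ 2`). [cite: ForbesShpilkaVolk2018, Cor. 5] -/
theorem fermat_mem_smallCircuits {n k : ℕ} (hn : 2 ≤ n) (hk : k ≤ n) :
    (∑ i : Fin k, C ((n : ℂ)⁻¹) * X (Fin.castLE hk i) ^ n : MvPolynomial (Fin n) ℂ) ∈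
      SmallCircuits ℂ n 3 := by
  refine ⟨totalDegree_fermat_le hk, (complexity_fermat_le hk _).trans ?_⟩
  calc k * (n + 2) ≤ n * (n + 2) := Nat.mul_le_mul_right _ hk
    _ ≤ n * (n * n) := Nat.mul_le_mul_left _ (by nlinarith)
    _ = n ^ 3 := by ring

/-- **The non-root is `VNP`-succinct**: the padded Fermat polynomial lies in `SmallDefinable ℂ n 3`
(a Boolean sum over ZERO Boolean variables of itself). [cite: KumarRamyaSaptharishiTengse2022, Def. 3] -/
theorem fermat_mem_smallDefinable {n k : ℕ} (hn : 2 ≤ n) (hk : k ≤ n) :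
    (∑ i : Fin k, C ((n : ℂ)⁻¹) * X (Fin.castLE hk i) ^ n : MvPolynomial (Fin n) ℂ) ∈
      SmallDefinable ℂ n 3 := by
  obtain ⟨hdeg, hcx⟩ := fermat_mem_smallCircuits hn hk
  refine ⟨hdeg, 0, Nat.zero_le _, rename (Sum.inl : Fin n → Fin n ⊕ Fin 0)
    (∑ i : Fin k, C ((n : ℂ)⁻¹) * X (Fin.castLE hk i) ^ n), ?_, ?_, ?_⟩
  · exact (complexity_rename_le_holds' _ _).trans hcx
  · exact (totalDegree_rename_le _ _).trans (hdeg.trans (Nat.le_self_pow (by norm_num) n))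
  · unfold boolSum
    conv_rhs => rw [Fintype.sum_unique, aeval_rename]
    exact (aeval_X_left_apply _).symm

/-! ### The linear-size range of item 18972 -/

/-- **Natural proofs separate `VNP` (indeed `VP₃`) from EVERY LINEAR SIZE, almost everywhere.** For
every `c` there are `a = 84c+39` and `n₀ = 2^(6c+3)+2` such that for all `n ≥ n₀` the distinguisher
`certPoly n (kOf c n)` of item 20156 is an FSV-natural proof of level `a` against
`{f : deg f ≤ n, L(f) ≤ c·n}` (Baur–Strassen × Macaulay, vanishing by the generic gradient-fibre count
`HBasis.gradientGenericFibreCount`, item 19256) with a NON-ROOT in `SmallDefinable ℂ n 3` (the padded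
Fermat polynomial). This is the statement of item 18972 with `SmallCircuits ℂ n b` replaced by linear
size `c·n` — its `b ≤ 1` range — at level `a(c)` and for all large `n` rather than infinitely often.
[cite: BaurStrassen1983] [cite: ForbesShpilkaVolk2018, Def. 1 and §1.2] -/
theorem naturalProofsSeparate_linearSize (c : ℕ) :
    ∃ a n₀ : ℕ, ∀ n : ℕ, n₀ ≤ n →
      ∃ D, IsNaturalProof (degLEMonomials n)
          {f : MvPolynomial (Fin n) ℂ | f.totalDegree ≤ n ∧ complexity f ≤ c * n}
          (Distinguishers ℂ n a) D ∧
        ∃ g ∈ SmallDefinable ℂ n 3, g ∈ SmallCircuits ℂ n 3 ∧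
          eval (coeffVector (degLEMonomials n) g) D ≠ 0 := by
  refine ⟨7 * (12 * c + 4) + 11, 2 ^ (6 * c + 3) + 2, fun n hn => ?_⟩
  have hn' : 2 ^ (6 * c + 3) + 1 ≤ n := by omega
  have h8 : 8 ≤ 2 ^ (6 * c + 3) := by
    calc (8 : ℕ) = 2 ^ 3 := by norm_num
      _ ≤ 2 ^ (6 * c + 3) := Nat.pow_le_pow_right (by norm_num) (by omega)
  have hn3 : 3 ≤ n := by omega
  obtain ⟨h1, hkn, hbig, hR⟩ := arith_core c n hn'
  have hB : 2 ≤ (2 * n).choose n := by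
    calc 2 = 2 ^ 1 := by norm_num
      _ ≤ 2 ^ n := Nat.pow_le_pow_right (by norm_num) h1
      _ ≤ (2 * n).choose n :=
          Literature.ModelTheory.FiniteModelTheory.two_pow_le_choose_two_mul_self n
  obtain ⟨hs1, hs2⟩ := size_arith hB hR (card_degLEMonomials_le_choose n)
  refine ⟨certPoly n (kOf c n), ⟨certPoly_mem_distinguishers hs1 hs2, certPoly_ne_zero h1 hkn, ?_⟩,
    ∑ i : Fin (kOf c n), C ((n : ℂ)⁻¹) * X (Fin.castLE hkn i) ^ n,
    fermat_mem_smallDefinable (by omega) hkn, fermat_mem_smallCircuits (by omega) hkn,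
    eval_certPoly_fermat_ne_zero h1 hkn⟩
  rintro f ⟨hfd, hfs⟩
  exact eval_certPoly_eq_zero (HBasis.gradientGenericFibreCount _ _ hn3) hbig f hfd hfs

/-- The same with the non-root recorded on the `VP` side only (`SmallCircuits ℂ n 3`): FSV-natural
proofs of level `84c+39` separate cubic-size `VP` from size `c·n`, all large `n`.
[cite: BaurStrassen1983] [cite: ForbesShpilkaVolk2018, §1.2] -/
theorem naturalProofsSeparate_linearSize_vp (c : ℕ) :
    ∃ a n₀ : ℕ, ∀ n : ℕ, n₀ ≤ n →
      ∃ D, IsNaturalProof (degLEMonomials n)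
          {f : MvPolynomial (Fin n) ℂ | f.totalDegree ≤ n ∧ complexity f ≤ c * n}
          (Distinguishers ℂ n a) D ∧
        ∃ g ∈ SmallCircuits ℂ n 3, eval (coeffVector (degLEMonomials n) g) D ≠ 0 := by
  obtain ⟨a, n₀, h⟩ := naturalProofsSeparate_linearSize c
  refine ⟨a, n₀, fun n hn => ?_⟩
  obtain ⟨D, hD, g, -, hg, hne⟩ := h n hn
  exact ⟨D, hD, g, hg, hne⟩

/-- **The `b = 1` instance of item 18972's level-`a` form HOLDS** (`a = 123`, `b₁ = 3`, and for all
large `n`): `SmallCircuits ℂ n 1 = {deg ≤ n, L ≤ n}` is linear size with `c = 1`. Compare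
`naturalProofsSeparateVNP_iff_level` (`…Level`): the item is `∃ b₁, ∀ b n₀, ∃ n ≥ n₀, …` at any fixed
level `a ≥ 1`; here `b = 1` is settled and `b ≥ 2` is the open super-linear regime.
[cite: BaurStrassen1983] [cite: ForbesShpilkaVolk2018, Question 6] -/
theorem naturalProofsSeparateVNP_range_one :
    ∃ a : ℕ, ∀ n₀ : ℕ, ∃ n : ℕ, n₀ ≤ n ∧
      ∃ D, IsNaturalProof (degLEMonomials n) (SmallCircuits ℂ n 1) (Distinguishers ℂ n a) D ∧
        ∃ g ∈ SmallDefinable ℂ n 3, eval (coeffVector (degLEMonomials n) g) D ≠ 0 := by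
  obtain ⟨a, n₁, h⟩ := naturalProofsSeparate_linearSize 1
  refine ⟨a, fun n₀ => ⟨max n₀ n₁, le_max_left _ _, ?_⟩⟩
  obtain ⟨D, ⟨hDmem, hD0, hvan⟩, g, hg, -, hne⟩ := h (max n₀ n₁) (le_max_right _ _)
  refine ⟨D, ⟨hDmem, hD0, fun f hf => hvan f ⟨hf.1, ?_⟩⟩, g, hg, hne⟩
  calc complexity f ≤ max n₀ n₁ ^ 1 := hf.2
    _ = 1 * max n₀ n₁ := by ring

/-- And the `b = 0` instance (`L ≤ 1`), for completeness of the range `b ≤ 1`.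
[cite: ForbesShpilkaVolk2018, Question 6] -/
theorem naturalProofsSeparateVNP_range_zero :
    ∃ a : ℕ, ∀ n₀ : ℕ, ∃ n : ℕ, n₀ ≤ n ∧
      ∃ D, IsNaturalProof (degLEMonomials n) (SmallCircuits ℂ n 0) (Distinguishers ℂ n a) D ∧
        ∃ g ∈ SmallDefinable ℂ n 3, eval (coeffVector (degLEMonomials n) g) D ≠ 0 := by
  obtain ⟨a, h⟩ := naturalProofsSeparateVNP_range_one
  refine ⟨a, fun n₀ => ?_⟩
  obtain ⟨n, hn, D, ⟨hDmem, hD0, hvan⟩, g, hg, hne⟩ := h (max n₀ 1)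
  refine ⟨n, (le_max_left _ _).trans hn, D, ⟨hDmem, hD0, fun f hf => hvan f ?_⟩, g, hg, hne⟩
  exact smallCircuits_mono ℂ (Nat.zero_le 1) ((le_max_right _ _).trans hn) hf

/-- **Range chart, packaged**: every `b ≤ 1` instance of the item's level-`a` form holds (one `a`,
one `b₁ = 3`, all large `n`). What the item adds is `∀ b` — already `b = 2` is an open super-linear
lower bound. [cite: ForbesShpilkaVolk2018, Question 6] [cite: BaurStrassen1983] -/
theorem naturalProofsSeparateVNP_range_le_one :
    ∃ a b₁ : ℕ, ∀ b : ℕ, b ≤ 1 → ∀ n₀ : ℕ, ∃ n : ℕ, n₀ ≤ n ∧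
      ∃ D, IsNaturalProof (degLEMonomials n) (SmallCircuits ℂ n b) (Distinguishers ℂ n a) D ∧
        ∃ g ∈ SmallDefinable ℂ n b₁, eval (coeffVector (degLEMonomials n) g) D ≠ 0 := by
  obtain ⟨a, h⟩ := naturalProofsSeparateVNP_range_one
  refine ⟨a, 3, fun b hb n₀ => ?_⟩
  obtain ⟨n, hn, D, ⟨hDmem, hD0, hvan⟩, g, hg, hne⟩ := h (max n₀ 1)
  refine ⟨n, (le_max_left _ _).trans hn, D, ⟨hDmem, hD0, fun f hf => hvan f ?_⟩, g, hg, hne⟩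
  exact smallCircuits_mono ℂ hb ((le_max_right _ _).trans hn) hf

end LinearRange

end Summit.ValiantsHypothesis.ValiantsHypothesis.Theorems.BarrierLever.NaturalProofsSeparateVNP

end
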